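import Summits.ResolutionOfSingularities.ResolutionOfSingularities.Theorems.PurelyInseparableDim4ResConeConeLetterEntry
import Summits.ResolutionOfSingularities.ResolutionOfSingularities.Theorems.PurelyInseparableDim4ResConeSatellitePair
import HarnessLib
import HarnessLib.Audit.Tags

/-!
# Purely inseparable four-folds — A PERMANENT LETTER OF A BINARY CONE IS A CONE LETTER FOR EVER: the TRANSVERSAL branch of the
# cone-letter dichotomy is EMPTY (ROW E-TRANS of the K2(7) rung-0 exit table), every prime `p`, every shade (cell `res-dim4-pi`)

[OURS · counted 0 · cell `res-dim4-pi` · K2(p) lane holder res-dim4-p-12 g5, rulings g5-6 (RUNG 0 EXITED 10:15Z): «ROW E-TRANS = the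
TRANSVERSAL branch: a frozen light letter that is NOT a cone letter from some time on — THE e = 2 CRUX OF K2(7): no kill typed or sketched;
owners of the TEXT idea-4/idea-1/p-9 (geometry)»; seat res-dim4-p-9 g5 over its own `…ConeLetterEntry` (p711866), res-dim4-p-12 g2/g3's
(I2) `chain_resVertex_step_inf_hyperplane_eq`, `chain_direction_mem_resVertex`, and res-dim4-p-5's free-tail theorem FT
(`exists_satellite_ge`).]  Nothing here proves any TAIL(7, d, e), K2(7), K2(p) or resolution of singularities in dimension ≥ 4 /
characteristic `p` — NOT proved; a statement about OUR frame's `Step0 p` chains.  AI kernel work, weaker than expert review.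

THE OBSERVATION.  On a constant-`(d, e_G = 2)` tail let the letter `z` be kept by the steps at `k` and `k + 1` (`j ≠ z`, `b z = 0`).  The
step directions `dir_k = direction (j k) (b k)`, `dir_{k+1}` lie in the polar kernels `V_k`, `V_{k+1}` (`chain_direction_mem_resVertex`) and
in `H_z` (their `z`-coordinate is `b z = 0`).  If `z` is TRANSVERSAL at `k` (`V_k ⊄ H_z`) then `V_k ⊓ H_z` is the line `K·dir_k`.  A
SATELLITE step at `k + 1` (`j (k+1) ≠ j k`, `b (k+1) (j k) = 0`) has `dir_{k+1} ∈ H_{j k}`, hence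
`dir_{k+1} ∈ V_{k+1} ⊓ H_{j k} = V_k ⊓ H_{j k}` by (I2) — so `dir_{k+1} ∈ V_k ⊓ H_z = K·dir_k`, and reading the `j k`-coordinate
(`(dir_k)_{j k} = 1`, `(dir_{k+1})_{j k} = 0`) gives `dir_{k+1} = 0`, absurd.  So **a transversal kept letter forbids a satellite at the
next step**; since framing is forward-stable (`transversal_of_le_of_permanent`) a PERMANENT letter transversal at one time would make the
tail eventually satellite-free, against FT.  Hence:
* `not_isSatellite_of_transversal_kept` — the one-step statement (any prime, any shade `d : ℕ∞`, `e_G ≡ 2`; NO `CharP`);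
* **`coneLetter_of_permanent`** — along a witnessed isolated above-floor `Step0 p` chain with `x^{r₀} ∣ F₀`, constant shade and `e_G = 2`
  from `k₀`, a letter PERMANENT from `k₁ ≥ k₀` (`∀ k ≥ k₁, j k ≠ z ∧ b k z = 0`) is a CONE LETTER at EVERY `k ≥ k₁`
  (`∀ v ∈ resVertex (c k), v z = 0`) — NO weight hypothesis, light or heavy (`[CharP K p]` enters through FT only);
* `permanentSet_coneLetters` — the same for every letter of a permanent set `P` (res-dim4-p-5 g5's frozen set of `good_modulo_frozen`).
CONSEQUENCE FOR THE EXIT TABLE (holder's wording to rule): ROW E-TRANS is EMPTY ‖ K; every frozen letter of the e = 2 residue is a cone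
letter along the whole tail, so the rung-2 mechanism «Φ-LINE WITH A FROZEN CONE MONOMIAL» (E_set/K_set/L_set) applies to the frozen set
WITHOUT a geometric side condition.  It does NOT touch the pure two-letter game (`P = ∅`) nor the `W ≤ t − 2` arithmetic.
[cite: CossartJannsenSaito2020, Thm. 3.10 (4), Thm. 3.14, Thm. 9.3] [cite: HauserPerlega2019PRIMS, §2]
bears_on: LADDER-RESOLUTION:D157-DOOR2 (res-dim4-pi · K2(p) · ROW E-TRANS empty).  Supports stmt-ResolutionOfSingularities-16155 (helper).
-/

set_option linter.dupNamespace false -- mandated namespace of this single-conjunct summit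

noncomputable section

namespace Summit.ResolutionOfSingularities.ResolutionOfSingularities.Theorems.PIDim4

namespace ResCone

open MvPolynomial Finset IsLocalRing
open Literature.AlgebraicGeometry.Resolution
open Literature.AlgebraicGeometry.Resolution.CentreBlowup
open Literature.AlgebraicGeometry.Resolution.Hauser2010
open Literature.AlgebraicGeometry.Resolution.HauserPerlega2019
open PointBlowup (additiveSubspace direction)

variable {K : Type} [Field K]

/-! ## 1. A transversal kept letter forbids a satellite at the next step -/

section Step

variable {p : ℕ} [Fact p.Prime] [DecidableEq K]

/-- **A TRANSVERSAL KEPT LETTER FORBIDS A SATELLITE AT THE NEXT STEP.**  Along a witnessed isolated above-floor `Step0 p` chain with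
`x^{r₀} ∣ F₀`, constant shade and `e_G = 2` from `k₀`, let `k ≥ k₀` and let the letter `z` be kept at `k` and at `k + 1`
(`j k ≠ z`, `b k z = 0`, `j (k+1) ≠ z`, `b (k+1) z = 0`).  If some kernel vector at `k` is transversal to `z`, then the step `k + 1` is
NOT a satellite of the step `k` (`¬ IsSatellite j b k`): otherwise `dir_{k+1} ∈ V_{k+1} ⊓ H_{j k} = V_k ⊓ H_{j k}` (I2) and
`dir_{k+1} ∈ H_z`, so `dir_{k+1} ∈ V_k ⊓ H_z = K·dir_k`, and the `j k`-coordinates `1` resp. `0` force `dir_{k+1} = 0`. [OURS]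
[cite: CossartJannsenSaito2020, Thm. 3.10 (4), Thm. 9.3] -/
theorem not_isSatellite_of_transversal_kept {c : ℕ → State K} {j : ℕ → Fin 4} {b : ℕ → Fin 4 → K}
    (hc : ∀ k, IsIsolated p (c k).F ∧ Step0 p (c k) (c (k + 1))) (hw : FreeTail.IsWitnessedChain p c j b)
    (hr0 : ∀ e ∈ (c 0).F.support, (c 0).r ≤ e) (hfloor : ∀ k, ordZero (c k).F ≠ p) {k₀ : ℕ} {d : ℕ∞}
    (hshade : ∀ k, k₀ ≤ k → (c k).shade = d) (he : ∀ k, k₀ ≤ k → Module.finrank K (resVertex (c k)) = 2)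
    {k : ℕ} (hk : k₀ ≤ k) {z : Fin 4} (hjz : j k ≠ z) (hbz : b k z = 0) (hjz₁ : j (k + 1) ≠ z) (hbz₁ : b (k + 1) z = 0)
    (htr : ∃ w ∈ resVertex (c k), w z ≠ 0) : ¬ FreeTail.IsSatellite j b k := by
  rintro ⟨hjj, hbj⟩
  obtain ⟨w, hwV, hwz⟩ := htr
  have hdir : direction (j k) (b k) ∈ resVertex (c k) := chain_direction_mem_resVertex p hc hw hr0 hfloor hshade hk
  have hdir₁ : direction (j (k + 1)) (b (k + 1)) ∈ resVertex (c (k + 1)) :=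
    chain_direction_mem_resVertex p hc hw hr0 hfloor hshade (show k₀ ≤ k + 1 by omega)
  have hI2 := chain_resVertex_step_inf_hyperplane_eq p hc hw hr0 hfloor hshade he hk
  -- `dir_{k+1}` lies in `H_{j k}` (satellite) hence, by (I2), in `V_k`
  have hdir₁j : direction (j (k + 1)) (b (k + 1)) (j k) = 0 := by rw [direction_apply_of_ne (Ne.symm hjj), hbj]
  have hdir₁V : direction (j (k + 1)) (b (k + 1)) ∈ resVertex (c k) := by
    have h : direction (j (k + 1)) (b (k + 1)) ∈ resVertex (c (k + 1)) ⊓ hyperplane (j k) :=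
      Submodule.mem_inf.mpr ⟨hdir₁, mem_hyperplane.mpr hdir₁j⟩
    rw [hI2] at h
    exact (Submodule.mem_inf.mp h).1
  -- both directions have `z`-coordinate `0`
  have hdirz : direction (j k) (b k) z = 0 := by rw [direction_apply_of_ne (Ne.symm hjz), hbz]
  have hdir₁z : direction (j (k + 1)) (b (k + 1)) z = 0 := by rw [direction_apply_of_ne (Ne.symm hjz₁), hbz₁]
  -- the plane `V_k` is spanned by `dir_k` (`j k`-coordinate `1`, `z`-coordinate `0`) and `m₄ := (w − w_{j k}·dir_k)/w_z`
  -- (`j k`-coordinate `0`, `z`-coordinate `1`); `dir_{k+1}` has both coordinates `0`, hence vanishes (`apply_eq_of_mem_plane`)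
  set m₄ : Fin 4 → K := (w z)⁻¹ • (w - w (j k) • direction (j k) (b k)) with hm₄
  have hm₄V : m₄ ∈ resVertex (c k) :=
    Submodule.smul_mem _ _ (Submodule.sub_mem _ hwV (Submodule.smul_mem _ _ hdir))
  have hm₄j : m₄ (j k) = 0 := by
    rw [hm₄, Pi.smul_apply, Pi.sub_apply, Pi.smul_apply, direction_apply_self, smul_eq_mul, smul_eq_mul, mul_one, sub_self,
      mul_zero]
  have hm₄z : m₄ z = 1 := by
    rw [hm₄, Pi.smul_apply, Pi.sub_apply, Pi.smul_apply, hdirz, smul_eq_mul, smul_eq_mul, mul_zero, sub_zero,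
      inv_mul_cancel₀ hwz]
  have hdec := apply_eq_of_mem_plane (he k hk) hdir hm₄V (direction_apply_self (j k) (b k)) hdirz hm₄j hm₄z hdir₁V
  have hzero : direction (j (k + 1)) (b (k + 1)) = 0 := by
    funext t
    rw [hdec t, hdir₁j, hdir₁z, zero_mul, zero_mul, add_zero, Pi.zero_apply]
  have h1 := congrFun hzero (j (k + 1))
  rw [direction_apply_self, Pi.zero_apply] at h1
  exact one_ne_zero h1

end Step

/-! ## 2. A permanent letter is a cone letter for ever -/

section Permanent

variable {p : ℕ} [Fact p.Prime] [CharP K p] [DecidableEq K]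

/-- **A PERMANENT LETTER OF A BINARY CONE IS A CONE LETTER FOR EVER** (ROW E-TRANS of the K2(7) rung-0 exit table is EMPTY).  Along a
witnessed isolated above-floor `Step0 p` chain with `x^{r₀} ∣ F₀`, constant shade `d` and `e_G = 2` from `k₀`, a letter `z` that is
neither the chart letter nor translated at any step `k ≥ k₁` (`k₁ ≥ k₀`) satisfies `∀ v ∈ resVertex (c k), v z = 0` at EVERY `k ≥ k₁`
— whatever its weight.  Proof: were `z` transversal at some `k₂ ≥ k₁`, it would stay transversal (`transversal_of_le_of_permanent`),
so by §1 no step after `k₂` is a satellite — a free tail, excluded by FT (`exists_satellite_ge`). [OURS]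
[cite: CossartJannsenSaito2020, Thm. 3.10 (4), Thm. 3.14, Thm. 9.3] -/
theorem coneLetter_of_permanent {c : ℕ → State K} {j : ℕ → Fin 4} {b : ℕ → Fin 4 → K}
    (hc : ∀ k, IsIsolated p (c k).F ∧ Step0 p (c k) (c (k + 1))) (hw : FreeTail.IsWitnessedChain p c j b)
    (hr0 : ∀ e ∈ (c 0).F.support, (c 0).r ≤ e) (hfloor : ∀ k, ordZero (c k).F ≠ p) {k₀ : ℕ} {d : ℕ∞}
    (hshade : ∀ k, k₀ ≤ k → (c k).shade = d) (he : ∀ k, k₀ ≤ k → Module.finrank K (resVertex (c k)) = 2)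
    {k₁ : ℕ} (hk₁ : k₀ ≤ k₁) {z : Fin 4} (hperm : ∀ k, k₁ ≤ k → j k ≠ z ∧ b k z = 0) :
    ∀ k, k₁ ≤ k → ∀ v ∈ resVertex (c k), v z = 0 := by
  by_contra hnot
  push Not at hnot
  obtain ⟨k₂, hk₂, v, hvV, hvz⟩ := hnot
  -- a satellite step beyond `k₂`
  obtain ⟨k, hk, hsat⟩ := exists_satellite_ge p hc hw k₂
  have htr : ∃ w ∈ resVertex (c k), w z ≠ 0 :=
    transversal_of_le_of_permanent hc hw hr0 hfloor hshade he hk₁ hperm hk₂ hk ⟨v, hvV, hvz⟩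
  exact not_isSatellite_of_transversal_kept hc hw hr0 hfloor hshade he (by omega) (hperm k (by omega)).1
    (hperm k (by omega)).2 (hperm (k + 1) (by omega)).1 (hperm (k + 1) (by omega)).2 htr hsat

/-- **Every letter of a PERMANENT SET is a cone letter for ever** (the frozen set `P` of res-dim4-p-5 g5's `good_modulo_frozen`):
with `∀ z ∈ P, ∀ k ≥ k₁, j k ≠ z ∧ b k z = 0` on a constant-`(d, e_G = 2)` tail, every `z ∈ P` is a cone letter at every `k ≥ k₁`, so
`P` joins the letter set `T` of `entryFrame_of_transversal_letters` UNCONDITIONALLY. [OURS]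
[cite: CossartJannsenSaito2020, Thm. 3.10 (4), Thm. 3.14] -/
theorem permanentSet_coneLetters {c : ℕ → State K} {j : ℕ → Fin 4} {b : ℕ → Fin 4 → K}
    (hc : ∀ k, IsIsolated p (c k).F ∧ Step0 p (c k) (c (k + 1))) (hw : FreeTail.IsWitnessedChain p c j b)
    (hr0 : ∀ e ∈ (c 0).F.support, (c 0).r ≤ e) (hfloor : ∀ k, ordZero (c k).F ≠ p) {k₀ : ℕ} {d : ℕ∞}
    (hshade : ∀ k, k₀ ≤ k → (c k).shade = d) (he : ∀ k, k₀ ≤ k → Module.finrank K (resVertex (c k)) = 2)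
    {k₁ : ℕ} (hk₁ : k₀ ≤ k₁) {P : Finset (Fin 4)} (hperm : ∀ z ∈ P, ∀ k, k₁ ≤ k → j k ≠ z ∧ b k z = 0) :
    ∀ z ∈ P, ∀ k, k₁ ≤ k → ∀ v ∈ resVertex (c k), v z = 0 :=
  fun z hz => coneLetter_of_permanent hc hw hr0 hfloor hshade he hk₁ (hperm z hz)

end Permanent

end ResCone

end Summit.ResolutionOfSingularities.ResolutionOfSingularities.Theorems.PIDim4

end
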